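import Summits.QuantumFields.BalabanUV.Beta.FP.BiVertexLimit

/-!
# `BalabanUV.Beta.FP.MixVertexLimit` — road «FP» for binder row D1, `RESIDUAL-FP.md` ROW #14 ∕ R-FP-41 (b) (owner, gen 10): THE MIXED BI-VERTEX `mixOfK K N M₂`
# (field column at the first bond, multiplier column at the second) IS LIPSCHITZ IN `(K, M₂)`, HENCE ITS CONSTRUCTED LIMIT ALONG (CONV-C)-TYPE RATES IS THE MIXED
# BI-VERTEX OF THE LIMITS — the second summand of `W2OfK` (the twin of `BiVertexLimit` for `vertex2OfK`); + its change of leg units (family form)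

HONEST DEPENDENCY (page 1, mandatory): continuum YM on T⁴ ⇐ BetaPertH ∧ nine spine estimates (0/9 proved); BetaPertH ⇐ (D1) ∧ (D4) ∧ CAP+tail;
G-an2-4 gates asym, D1 and NE2/3/4.  HONEST FRAMING (cell contract, verbatim): «discharging `BetaPertH` makes Bałaban's UV stability UNCONDITIONAL —
a real constructive-QFT result; it is NOT the continuum limit and NOT the Clay problem.»  THIS MODULE is [folklore] kernel bookkeeping (absolutely
convergent lattice sums, explicit constants; no `def`, no `def … : Prop`, nothing cited, 0 sorry).  Every rate ∕ row below is a HYPOTHESIS SHAPE with free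
constants (X1-type data for a resolvent family and a field–multiplier table family), asserted for no object of Bałaban's.  0∕4 row-D1 binders; NOT X1, NOT row
#14 for the literal, NOT (G-mix-W), NOT (ASYMP), NOT D1, NOT BetaPertH, NOT continuum, NOT Clay.  «not in print; our bookkeeping».

ABSOLUTE RULE (cell charter, verbatim): «No internally-minted statement may enter as a cited fact. Every hypothesis is either kernel-proved in this package or a
verbatim quotation of a PUBLISHED theorem with page reference. The manuscript(s) under audit are NOT citable for their own disputed steps — they are the thing
under adjudication; programme-internal (2001/route/tribunal) claims are never citable.»

WHY.  The literal's second-order slot is `W2OfK = vertex2OfK + mixOfK + mixOfK′ + dM (K2OfK …)` (`SecondOrderResponse`, by definition; an2's `W2SymOfK` its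
symmetrisation).  Row #14's displayed `hsplit` puts the bi-vertex summand into the (ASYMP) socket and the REST into `Wx m`, whose constructed limit must be
identified summand by summand (`BiVertexLimit.limTabOf_add_of_tendsto` needs entrywise convergence of each summand).  `BiVertexLimit` did the bi-vertex; this file
does the two MIXED summands: `mixOfK K N M₂ μ y ν y′ = vertexOfK K N (κ u ↦ vertexOfM K N (M₂ κ u) ν y′) μ y` has a LOCAL inner family (localised at the fine
bond `u` itself, because `M₂ κ u` is), so the outer level is EXACTLY asym1's `HessKerRate.vertexFamily_vertexOfK_sub`; the inner level is a coarse-indexed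
superposition `cwsum` of uniformly localised tables (§1, via `BiVertexLimit.biLoc_wsum_(sub_)unif`).  Under R-FP-41 (the (j, m)-families of record) the multiplier
tables for m ≥ 2 are the EXPLICIT composite-averaging jets, so their rows are letters about explicit objects.

CONTENT.
* §1 [folklore] `unitW_mixOfK` (family form of `SecondOrderUnits.mixOfK_unit`); coarse-indexed superpositions with UNIFORMLY localised kernels:
  `biLoc_cwsum_unif`, `biLoc_cwsum_sub_unif` (extension by zero `onLat` + `BiVertexLimit.biLoc_wsum_(sub_)unif`).
* §2 [folklore] the inner multiplier vertex `vertexOfM K N T ν y′` for tables uniformly localised at a fixed fine pair: `biLoc_vertexOfM_unif`,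
  `biLoc_vertexOfM_sub_unif` (Lipschitz in `(K, T)`; weights = the multiplier column `colM K`, decaying from `N•y′`).
* §3 [folklore] the inner families of `mixOfK` are `LocStencil`: `locStencil_innerMix`, `locStencil_innerMix_sub` (from `LocStencilFM N M₂ C₂ m`, separation weight
  dropped); **`biLoc_mixOfK_sub`** (THE MIXED BI-VERTEX IS LIPSCHITZ IN `(K, M₂)`, one-centre `BiLoc` at `(N•y, N•y)`, rate `m/2`, explicit constant),
  **`biLoc_mixOfK_rate`**, **`limTabOf_mixOfK_eq`**, `tendsto_mixOfK`, and the exchanged order `tendsto_mixOfK_swap` ∕ **`limTabOf_mixOfK_swap_eq`**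
  (the third summand `mixOfK … ν y′ μ y`).
Provenance: road FP OWNER b2b-balaban-beta-d1-p3 gen 10 (prover-b2b-balaban-beta-d1-p3-g10-0), 2026-08-21, row #14 ∕ R-FP-41 (b).
-/

noncomputable section

namespace Summit.QuantumFields.BalabanUV.Beta.FP.MixVertexLimit

open Filter Topology
open Literature.MathematicalPhysics.QuantumFieldTheory
open Literature.MathematicalPhysics.QuantumFieldTheory.Balaban1983to89
open Literature.MathematicalPhysics.QuantumFieldTheory.Balaban1983to89.Beta
open Literature.Probability.LatticeModels (Torus.proj)
open LatticeForm (quo)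
open B12Sec2to5 (l1 l1_nonneg)
open ExpKernelCalculus (Site MKer Decays BiLoc VertexFamily Zl)
open OneStepResolventKernel (Fib LocStencil wsum biLoc_finset_sum eq_zsmul_quo_of_proj)
open OneStepKernelFamily (vertexOfK vertexFamily_vertexOfK)
open InterLevelTransport (onLat onLat_off cwsum)
open SecondOrderResponse (colM vertexOfM mixOfK LocStencilFM)
open HessKerRate (vertexFamily_vertexOfK_sub)
open HessKerDressedLimit (limMKerOf limTabOf limTabOf_apply limMKerOf_eq_of_biLoc_rate tendsto_of_biLoc_rate mker_sub_apply
  limMKerOf_eq_of_tendsto)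
open Summit.QuantumFields.BalabanUV.Beta.HessKerDressedUnits (unitK unitW)
open Summit.QuantumFields.BalabanUV.Beta.SecondOrderUnits (unitM₂ mixOfK_unit)
open Summit.QuantumFields.BalabanUV.Beta.FP.BiVertexLimit (biLoc_wsum_unif biLoc_wsum_sub_unif)

variable {d : ℕ}

/-! ## §1 Units; coarse-indexed superpositions of uniformly localised kernels -/

section Units

variable {N : ℕ} [NeZero N]

/-- [folklore] **THE MIXED BI-VERTEX IN LEG UNITS, FAMILY FORM**: `unitW sf sm (mixOfK K N M₂) = mixOfK (D K D) N (unitM₂ sf sm M₂)` — the tree's pointwise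
`SecondOrderUnits.mixOfK_unit` read as an equality of table families. -/
theorem unitW_mixOfK {sf sm : ℝ} (hsf : sf ≠ 0) (hsm : sm ≠ 0) (K : MKer (d + 1) (Fib d))
    (M₂ : Fin (d + 1) → (Fin (d + 1) → ℤ) → Fin (d + 1) → (Fin (d + 1) → ℤ) → MKer (d + 1) (Fib d)) :
    unitW sf sm (mixOfK K N M₂) = mixOfK (unitK sf sm K) N (unitM₂ sf sm M₂) :=
  funext fun μ => funext fun y => funext fun ν => funext fun y' => (mixOfK_unit (N := N) hsf hsm K M₂ μ y ν y').symm

end Units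

section CoarseSums

variable {N : ℕ} [NeZero N]

/-- [folklore] Extension by zero of coarse weights decaying (in fine units) from `p`: the fine weight `onLat N w` decays from `p` with the same constant. -/
theorem abs_onLat_le {w : (Fin (d + 1) → ℤ) → ℝ} {C m : ℝ} {p : Fin (d + 1) → ℤ} (hw : ∀ y, |w y| ≤ C * Real.exp (-m * l1 ((N : ℤ) • y - p)))
    (v : Fin (d + 1) → ℤ) : |onLat N w v| ≤ C * Real.exp (-m * l1 (v - p)) := by
  have hC : 0 ≤ C := le_of_mul_le_mul_right ((abs_nonneg _).trans (hw 0) |>.trans_eq' (by ring)) (Real.exp_pos _)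
  by_cases hv : Torus.proj N v = 0
  · have e := eq_zsmul_quo_of_proj (N := N) hv
    simp only [onLat, hv, if_true]
    have h := hw (quo N v)
    rwa [← e] at h
  · rw [onLat_off w hv, abs_zero]
    positivity

omit [NeZero N] in
/-- [folklore] Extension by zero of a coarse-indexed kernel family UNIFORMLY bi-localised at `(q, q′)`: the fine family `onLat N Q` is too. -/
theorem biLoc_onLat_unif {Q : (Fin (d + 1) → ℤ) → MKer (d + 1) (Fib d)} {B δ' : ℝ} {q q' : Fin (d + 1) → ℤ} (hQ : ∀ y, BiLoc (Q y) q q' B δ')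
    (v : Fin (d + 1) → ℤ) : BiLoc (onLat N Q v) q q' B δ' := by
  have hB : 0 ≤ B := (hQ 0).nonneg (Sum.inl 0)
  by_cases hv : Torus.proj N v = 0
  · simp only [onLat, hv, if_true]
    exact hQ (quo N v)
  · intro x z a b
    rw [onLat_off Q hv]
    show |(0 : ℝ)| ≤ _
    rw [abs_zero]
    positivity

/-- [folklore] **COARSE-INDEXED SUPERPOSITION, UNIFORMLY LOCALISED KERNELS — BOUND**: weights decaying (fine units, rate `m > 0`) from `p` as a function of the coarse
point `N•y`, kernels ALL bi-localised at the same pair `(q, q′)` ⟹ `BiLoc (cwsum N w Q) q q′ (C·Zl(m)·B) δ′`. -/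
theorem biLoc_cwsum_unif {w : (Fin (d + 1) → ℤ) → ℝ} {Q : (Fin (d + 1) → ℤ) → MKer (d + 1) (Fib d)} {C B m δ' : ℝ} {p q q' : Fin (d + 1) → ℤ}
    (hw : ∀ y, |w y| ≤ C * Real.exp (-m * l1 ((N : ℤ) • y - p))) (hQ : ∀ y, BiLoc (Q y) q q' B δ') (hm : 0 < m) :
    BiLoc (cwsum N w Q) q q' (C * Zl (d + 1) m * B) δ' :=
  biLoc_wsum_unif (abs_onLat_le hw) (biLoc_onLat_unif hQ) hm

/-- [folklore] **COARSE-INDEXED SUPERPOSITION — LIPSCHITZ IN (weights, kernels)** (uniformly localised kernels). -/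
theorem biLoc_cwsum_sub_unif {w w' : (Fin (d + 1) → ℤ) → ℝ} {Q Q' : (Fin (d + 1) → ℤ) → MKer (d + 1) (Fib d)} {C C' εw B B' εQ m δ' : ℝ}
    {p q q' : Fin (d + 1) → ℤ}
    (hw : ∀ y, |w y| ≤ C * Real.exp (-m * l1 ((N : ℤ) • y - p))) (hw' : ∀ y, |w' y| ≤ C' * Real.exp (-m * l1 ((N : ℤ) • y - p)))
    (hww : ∀ y, |w y - w' y| ≤ εw * Real.exp (-m * l1 ((N : ℤ) • y - p)))
    (hQ : ∀ y, BiLoc (Q y) q q' B δ') (hQ' : ∀ y, BiLoc (Q' y) q q' B' δ') (hQQ : ∀ y, BiLoc (Q y - Q' y) q q' εQ δ') (hm : 0 < m) :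
    BiLoc (cwsum N w Q - cwsum N w' Q') q q' ((εw * B + C' * εQ) * Zl (d + 1) m) δ' := by
  have hww' : ∀ v, |onLat N w v - onLat N w' v| ≤ εw * Real.exp (-m * l1 (v - p)) := fun v => by
    have h := abs_onLat_le (N := N) (w := fun y => w y - w' y) hww v
    by_cases hv : Torus.proj N v = 0
    · simpa only [onLat, hv, if_true] using h
    · simpa only [onLat_off _ hv, sub_zero] using h
  have hQQ' : ∀ v, BiLoc (onLat N Q v - onLat N Q' v) q q' εQ δ' := fun v => by
    have h := biLoc_onLat_unif (N := N) (Q := fun y => Q y - Q' y) hQQ v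
    by_cases hv : Torus.proj N v = 0
    · simpa only [onLat, hv, if_true] using h
    · simpa only [onLat_off _ hv, sub_zero] using h
  exact biLoc_wsum_sub_unif (abs_onLat_le hw) (abs_onLat_le hw') hww' (biLoc_onLat_unif hQ) (biLoc_onLat_unif hQ') hQQ' hm

end CoarseSums

/-! ## §2 The inner multiplier vertex for uniformly localised tables -/

section InnerM

variable {N : ℕ} [NeZero N]

omit [NeZero N] in
/-- [folklore] The multiplier column of a decaying kernel decays (fine units) from the coarse point `N•y′`. -/
theorem abs_colM_le {K : MKer (d + 1) (Fib d)} {C m : ℝ} (hK : Decays K C m) (ν : Fin (d + 1)) (y' : Fin (d + 1) → ℤ) (ρ : Fin (d + 1))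
    (w : Fin (d + 1) → ℤ) : |colM K N ν y' ρ w| ≤ C * Real.exp (-m * l1 ((N : ℤ) • w - (N : ℤ) • y')) :=
  hK _ _ _ _

/-- [folklore] **THE INNER MULTIPLIER VERTEX, UNIFORM**: for `Decays K C m` and a multiplier table family `T ρ w` ALL bi-localised at `(q, q)`,
`BiLoc (vertexOfM K N T ν y′) q q ((d+1)·(C·Zl(m)·B)) δ′`. -/
theorem biLoc_vertexOfM_unif {K : MKer (d + 1) (Fib d)} {C m : ℝ} (hK : Decays K C m) (hm : 0 < m)
    {T : Fin (d + 1) → (Fin (d + 1) → ℤ) → MKer (d + 1) (Fib d)} {B δ' : ℝ} {q : Fin (d + 1) → ℤ} (hT : ∀ ρ w, BiLoc (T ρ w) q q B δ')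
    (ν : Fin (d + 1)) (y' : Fin (d + 1) → ℤ) : BiLoc (vertexOfM K N T ν y') q q ((d + 1 : ℕ) * (C * Zl (d + 1) m * B)) δ' := by
  have hterm : ∀ ρ : Fin (d + 1), BiLoc (cwsum N (colM K N ν y' ρ) (T ρ)) q q (C * Zl (d + 1) m * B) δ' :=
    fun ρ => biLoc_cwsum_unif (fun w => abs_colM_le (N := N) hK ν y' ρ w) (hT ρ) hm
  have hsum := biLoc_finset_sum (Finset.univ : Finset (Fin (d + 1))) (fun ρ _ => hterm ρ)
  simp only [Finset.sum_const, Finset.card_univ, Fintype.card_fin, nsmul_eq_mul] at hsum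
  exact hsum

/-- [folklore] **THE INNER MULTIPLIER VERTEX IS LIPSCHITZ IN `(K, T)`** (uniformly localised tables): deviations `εK` (in `Decays`) and `εT` ⟹
`BiLoc (vertexOfM K N T ν y′ − vertexOfM K′ N T′ ν y′) q q ((d+1)·((εK·B + C′·εT)·Zl(m))) δ′`. -/
theorem biLoc_vertexOfM_sub_unif {K K' : MKer (d + 1) (Fib d)} {C C' εK m : ℝ} (hK : Decays K C m) (hK' : Decays K' C' m)
    (hKK : Decays (K - K') εK m) (hm : 0 < m)
    {T T' : Fin (d + 1) → (Fin (d + 1) → ℤ) → MKer (d + 1) (Fib d)} {B B' εT δ' : ℝ} {q : Fin (d + 1) → ℤ}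
    (hT : ∀ ρ w, BiLoc (T ρ w) q q B δ') (hT' : ∀ ρ w, BiLoc (T' ρ w) q q B' δ') (hTT : ∀ ρ w, BiLoc (T ρ w - T' ρ w) q q εT δ')
    (ν : Fin (d + 1)) (y' : Fin (d + 1) → ℤ) :
    BiLoc (vertexOfM K N T ν y' - vertexOfM K' N T' ν y') q q ((d + 1 : ℕ) * ((εK * B + C' * εT) * Zl (d + 1) m)) δ' := by
  have hterm : ∀ ρ : Fin (d + 1), BiLoc (cwsum N (colM K N ν y' ρ) (T ρ) - cwsum N (colM K' N ν y' ρ) (T' ρ)) q q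
      ((εK * B + C' * εT) * Zl (d + 1) m) δ' := fun ρ =>
    biLoc_cwsum_sub_unif (fun w => abs_colM_le (N := N) hK ν y' ρ w) (fun w => abs_colM_le (N := N) hK' ν y' ρ w)
      (fun w => abs_colM_le (N := N) hKK ν y' ρ w) (hT ρ) (hT' ρ) (hTT ρ) hm
  have hsum := biLoc_finset_sum (Finset.univ : Finset (Fin (d + 1))) (fun ρ _ => hterm ρ)
  simp only [Finset.sum_const, Finset.card_univ, Fintype.card_fin, nsmul_eq_mul] at hsum
  have e : vertexOfM K N T ν y' - vertexOfM K' N T' ν y' = fun x z a b => ∑ ρ : Fin (d + 1),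
      (cwsum N (colM K N ν y' ρ) (T ρ) - cwsum N (colM K' N ν y' ρ) (T' ρ)) x z a b := by
    funext x z a b
    simp only [vertexOfM, Pi.sub_apply, Finset.sum_sub_distrib]
  rw [e]
  exact hsum

end InnerM

/-! ## §3 The mixed bi-vertex is Lipschitz in `(K, M₂)`; its constructed limit -/

section Mix

variable {N : ℕ} [NeZero N]

omit [NeZero N] in
/-- [folklore] A `LocStencilFM` slice, separation weight dropped: every `M₂ κ u ρ w` is bi-localised at `(u, u)` with constant `C₂`. -/
theorem biLoc_slice_of_locStencilFM {M₂ : Fin (d + 1) → (Fin (d + 1) → ℤ) → Fin (d + 1) → (Fin (d + 1) → ℤ) → MKer (d + 1) (Fib d)}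
    {C₂ m : ℝ} (hM₂ : LocStencilFM N M₂ C₂ m) (hm : 0 ≤ m) (κ : Fin (d + 1)) (u : Fin (d + 1) → ℤ) (ρ : Fin (d + 1)) (w : Fin (d + 1) → ℤ) :
    BiLoc (M₂ κ u ρ w) u u C₂ m := by
  have hC₂ := hM₂.nonneg
  intro x z a b
  refine (hM₂ κ u ρ w x z a b).trans (mul_le_mul_of_nonneg_right ?_ (Real.exp_pos _).le)
  have he : Real.exp (-m * l1 (u - (N : ℤ) • w)) ≤ 1 := by
    rw [Real.exp_le_one_iff]; nlinarith [l1_nonneg (u - (N : ℤ) • w)]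
  calc C₂ * Real.exp (-m * l1 (u - (N : ℤ) • w)) ≤ C₂ * 1 := mul_le_mul_of_nonneg_left he hC₂
    _ = C₂ := mul_one _

/-- [folklore] **THE INNER FAMILY OF THE MIXED BI-VERTEX IS A LOCAL STENCIL FAMILY**: `κ u ↦ vertexOfM K N (M₂ κ u) ν y′` is
`LocStencil … ((d+1)·(C·Zl(m)·C₂)) m` (localised at its own fine bond `u`, because `M₂ κ u` is). -/
theorem locStencil_innerMix {K : MKer (d + 1) (Fib d)} {C m : ℝ} (hK : Decays K C m) (hm : 0 < m)
    {M₂ : Fin (d + 1) → (Fin (d + 1) → ℤ) → Fin (d + 1) → (Fin (d + 1) → ℤ) → MKer (d + 1) (Fib d)} {C₂ : ℝ} (hM₂ : LocStencilFM N M₂ C₂ m)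
    (ν : Fin (d + 1)) (y' : Fin (d + 1) → ℤ) :
    LocStencil (fun κ u => vertexOfM K N (M₂ κ u) ν y') ((d + 1 : ℕ) * (C * Zl (d + 1) m * C₂)) m :=
  fun κ u => biLoc_vertexOfM_unif hK hm (fun ρ w => biLoc_slice_of_locStencilFM hM₂ hm.le κ u ρ w) ν y'

/-- [folklore] … and its deviation between two data `(K, M₂)`, `(K′, M₂′)` is a local stencil family with constant `(d+1)·((εK·C₂ + C′·ε₂)·Zl(m))`. -/
theorem locStencil_innerMix_sub {K K' : MKer (d + 1) (Fib d)} {C C' εK m : ℝ} (hK : Decays K C m) (hK' : Decays K' C' m)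
    (hKK : Decays (K - K') εK m) (hm : 0 < m)
    {M₂ M₂' : Fin (d + 1) → (Fin (d + 1) → ℤ) → Fin (d + 1) → (Fin (d + 1) → ℤ) → MKer (d + 1) (Fib d)} {C₂ C₂' ε₂ : ℝ}
    (hM₂ : LocStencilFM N M₂ C₂ m) (hM₂' : LocStencilFM N M₂' C₂' m) (hMM : LocStencilFM N (M₂ - M₂') ε₂ m)
    (ν : Fin (d + 1)) (y' : Fin (d + 1) → ℤ) :
    LocStencil ((fun κ u => vertexOfM K N (M₂ κ u) ν y') - fun κ u => vertexOfM K' N (M₂' κ u) ν y')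
      ((d + 1 : ℕ) * ((εK * C₂ + C' * ε₂) * Zl (d + 1) m)) m := fun κ u => by
  have h := biLoc_vertexOfM_sub_unif (N := N) hK hK' hKK hm (fun ρ w => biLoc_slice_of_locStencilFM hM₂ hm.le κ u ρ w)
    (fun ρ w => biLoc_slice_of_locStencilFM hM₂' hm.le κ u ρ w) (fun ρ w => biLoc_slice_of_locStencilFM hMM hm.le κ u ρ w) ν y'
  simpa only [Pi.sub_apply] using h

/-- [folklore] **THE MIXED BI-VERTEX IS LIPSCHITZ IN `(K, M₂)`** (one-centre `BiLoc` at `(N•y, N•y)`, rate `m/2`, explicit constant): for `K, K′` decaying at rate `m`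
(difference `εK`) and field–multiplier tables `M₂, M₂′` (`LocStencilFM`, difference `ε₂`), every `(μ, y, ν, y′)`:
`BiLoc (mixOfK K N M₂ μ y ν y′ − mixOfK K′ N M₂′ μ y ν y′) (N•y) (N•y) ((d+1)·((εK·B + C′·εin)·Zl(m/2))) (m/2)`, `B = (d+1)·C·Zl(m)·C₂`,
`εin = (d+1)·(εK·C₂ + C′·ε₂)·Zl(m)` — asym1's `HessKerRate.vertexFamily_vertexOfK_sub` on the inner local families of §3. -/
theorem biLoc_mixOfK_sub {K K' : MKer (d + 1) (Fib d)} {C C' εK m : ℝ} (hK : Decays K C m) (hK' : Decays K' C' m)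
    (hKK : Decays (K - K') εK m) (hm : 0 < m)
    {M₂ M₂' : Fin (d + 1) → (Fin (d + 1) → ℤ) → Fin (d + 1) → (Fin (d + 1) → ℤ) → MKer (d + 1) (Fib d)} {C₂ C₂' ε₂ : ℝ}
    (hM₂ : LocStencilFM N M₂ C₂ m) (hM₂' : LocStencilFM N M₂' C₂' m) (hMM : LocStencilFM N (M₂ - M₂') ε₂ m)
    (μ : Fin (d + 1)) (y : Fin (d + 1) → ℤ) (ν : Fin (d + 1)) (y' : Fin (d + 1) → ℤ) :
    BiLoc (mixOfK K N M₂ μ y ν y' - mixOfK K' N M₂' μ y ν y') ((N : ℤ) • y) ((N : ℤ) • y)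
      ((d + 1 : ℕ) * ((εK * ((d + 1 : ℕ) * (C * Zl (d + 1) m * C₂)) + C' * ((d + 1 : ℕ) * ((εK * C₂ + C' * ε₂) * Zl (d + 1) m))) *
        Zl (d + 1) (m / 2))) (m / 2) := by
  have h := vertexFamily_vertexOfK_sub hK hK' hKK (locStencil_innerMix (N := N) hK hm hM₂ ν y') (locStencil_innerMix (N := N) hK' hm hM₂' ν y')
    (locStencil_innerMix_sub (N := N) hK hK' hKK hm hM₂ hM₂' hMM ν y') hm le_rfl N μ y
  simpa only [mixOfK, Pi.sub_apply] using h

variable {K : ℕ → MKer (d + 1) (Fib d)} {Kinf : MKer (d + 1) (Fib d)}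
  {M₂ : ℕ → Fin (d + 1) → (Fin (d + 1) → ℤ) → Fin (d + 1) → (Fin (d + 1) → ℤ) → MKer (d + 1) (Fib d)}
  {M₂inf : Fin (d + 1) → (Fin (d + 1) → ℤ) → Fin (d + 1) → (Fin (d + 1) → ℤ) → MKer (d + 1) (Fib d)} {C cK C₂ c₂ m θ : ℝ}

/-- [folklore] **RATE FORM**: geometric rates of `(K_j, M₂,j)` to `(K∞, M₂∞)` with uniform rows ⟹ `mixOfK (K j) N (M₂ j) → mixOfK K∞ N M₂∞` geometrically, entry family by
entry family, in one-centre `BiLoc`. -/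
theorem biLoc_mixOfK_rate (hK : ∀ j, Decays (K j) C m) (hKinf : Decays Kinf C m) (hKrate : ∀ j, Decays (K j - Kinf) (cK * θ ^ j) m)
    (hM : ∀ j, LocStencilFM N (M₂ j) C₂ m) (hMinf : LocStencilFM N M₂inf C₂ m) (hMrate : ∀ j, LocStencilFM N (M₂ j - M₂inf) (c₂ * θ ^ j) m)
    (hm : 0 < m) (μ : Fin (d + 1)) (y : Fin (d + 1) → ℤ) (ν : Fin (d + 1)) (y' : Fin (d + 1) → ℤ) (j : ℕ) :
    BiLoc (mixOfK (K j) N (M₂ j) μ y ν y' - mixOfK Kinf N M₂inf μ y ν y') ((N : ℤ) • y) ((N : ℤ) • y)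
      ((d + 1 : ℕ) * ((cK * ((d + 1 : ℕ) * (C * Zl (d + 1) m * C₂)) + C * ((d + 1 : ℕ) * ((cK * C₂ + C * c₂) * Zl (d + 1) m))) *
        Zl (d + 1) (m / 2)) * θ ^ j) (m / 2) := by
  have h := biLoc_mixOfK_sub (N := N) (hK j) hKinf (hKrate j) hm (hM j) hMinf (hMrate j) μ y ν y'
  intro x z a b
  refine (h x z a b).trans (le_of_eq ?_)
  ring

/-- [folklore] **THE CONSTRUCTED LIMIT OF THE MIXED BI-VERTEX FAMILY IS THE MIXED BI-VERTEX OF THE LIMITS** (`0 ≤ θ < 1`). -/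
theorem limTabOf_mixOfK_eq (hK : ∀ j, Decays (K j) C m) (hKinf : Decays Kinf C m) (hKrate : ∀ j, Decays (K j - Kinf) (cK * θ ^ j) m)
    (hM : ∀ j, LocStencilFM N (M₂ j) C₂ m) (hMinf : LocStencilFM N M₂inf C₂ m) (hMrate : ∀ j, LocStencilFM N (M₂ j - M₂inf) (c₂ * θ ^ j) m)
    (hm : 0 < m) (hθ0 : 0 ≤ θ) (hθ1 : θ < 1) :
    limTabOf (fun j => mixOfK (K j) N (M₂ j)) = mixOfK Kinf N M₂inf :=
  funext fun μ => funext fun y => funext fun ν => funext fun y' =>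
    limMKerOf_eq_of_biLoc_rate (T := fun j => mixOfK (K j) N (M₂ j) μ y ν y')
      (fun k => biLoc_mixOfK_rate (N := N) hK hKinf hKrate hM hMinf hMrate hm μ y ν y' k) hθ0 hθ1

/-- [folklore] … and the entrywise convergence itself. -/
theorem tendsto_mixOfK (hK : ∀ j, Decays (K j) C m) (hKinf : Decays Kinf C m) (hKrate : ∀ j, Decays (K j - Kinf) (cK * θ ^ j) m)
    (hM : ∀ j, LocStencilFM N (M₂ j) C₂ m) (hMinf : LocStencilFM N M₂inf C₂ m) (hMrate : ∀ j, LocStencilFM N (M₂ j - M₂inf) (c₂ * θ ^ j) m)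
    (hm : 0 < m) (hθ0 : 0 ≤ θ) (hθ1 : θ < 1) (μ : Fin (d + 1)) (y : Fin (d + 1) → ℤ) (ν : Fin (d + 1)) (y' : Fin (d + 1) → ℤ)
    (x z : Fin (d + 1) → ℤ) (a b : Fib d) :
    Tendsto (fun j => mixOfK (K j) N (M₂ j) μ y ν y' x z a b) atTop (𝓝 (mixOfK Kinf N M₂inf μ y ν y' x z a b)) :=
  tendsto_of_biLoc_rate (T := fun j => mixOfK (K j) N (M₂ j) μ y ν y')
    (fun k => biLoc_mixOfK_rate (N := N) hK hKinf hKrate hM hMinf hMrate hm μ y ν y' k) hθ0 hθ1 x z a b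

/-- [folklore] THE EXCHANGED ORDER (the third summand of `W2OfK`, multiplier column at the FIRST bond): the same convergence, indices swapped. -/
theorem tendsto_mixOfK_swap (hK : ∀ j, Decays (K j) C m) (hKinf : Decays Kinf C m) (hKrate : ∀ j, Decays (K j - Kinf) (cK * θ ^ j) m)
    (hM : ∀ j, LocStencilFM N (M₂ j) C₂ m) (hMinf : LocStencilFM N M₂inf C₂ m) (hMrate : ∀ j, LocStencilFM N (M₂ j - M₂inf) (c₂ * θ ^ j) m)
    (hm : 0 < m) (hθ0 : 0 ≤ θ) (hθ1 : θ < 1) (μ : Fin (d + 1)) (y : Fin (d + 1) → ℤ) (ν : Fin (d + 1)) (y' : Fin (d + 1) → ℤ)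
    (x z : Fin (d + 1) → ℤ) (a b : Fib d) :
    Tendsto (fun j => mixOfK (K j) N (M₂ j) ν y' μ y x z a b) atTop (𝓝 (mixOfK Kinf N M₂inf ν y' μ y x z a b)) :=
  tendsto_mixOfK (N := N) hK hKinf hKrate hM hMinf hMrate hm hθ0 hθ1 ν y' μ y x z a b

/-- [folklore] **THE CONSTRUCTED LIMIT OF THE EXCHANGED MIXED FAMILY** `j ↦ (μ y ν y′ ↦ mixOfK (K j) N (M₂ j) ν y′ μ y)` is the exchanged mixed bi-vertex of the limits. -/
theorem limTabOf_mixOfK_swap_eq (hK : ∀ j, Decays (K j) C m) (hKinf : Decays Kinf C m) (hKrate : ∀ j, Decays (K j - Kinf) (cK * θ ^ j) m)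
    (hM : ∀ j, LocStencilFM N (M₂ j) C₂ m) (hMinf : LocStencilFM N M₂inf C₂ m) (hMrate : ∀ j, LocStencilFM N (M₂ j - M₂inf) (c₂ * θ ^ j) m)
    (hm : 0 < m) (hθ0 : 0 ≤ θ) (hθ1 : θ < 1) :
    limTabOf (fun j μ y ν y' => mixOfK (K j) N (M₂ j) ν y' μ y) = fun μ y ν y' => mixOfK Kinf N M₂inf ν y' μ y :=
  funext fun μ => funext fun y => funext fun ν => funext fun y' => by
    rw [limTabOf_apply]
    exact limMKerOf_eq_of_tendsto fun x z a b => tendsto_mixOfK_swap (N := N) hK hKinf hKrate hM hMinf hMrate hm hθ0 hθ1 μ y ν y' x z a b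

end Mix

end Summit.QuantumFields.BalabanUV.Beta.FP.MixVertexLimit

end
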